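import Summits.CriticalPhenomena.PercolationContinuityZ3.Theorems.PercNearOneGluingAdditiveGluingFibreCriterion
import Literature.Probability.Percolation.ConditionalPositiveAssociationProofs
import HarnessLib

/-!
# Crux `PercNearOneGluing.AdditiveGluing` (stmt-CriticalPhenomena-4576), line `tieline`:
# tools for exact replica-swap involutions on fibres — open paths across a 2-vertex separator, and the swap `1 ↔ 3`

Support file (`--supports stmt-CriticalPhenomena-4576`, helper, seat (d) exchange-certificate form).  No named facts,
no sorries; no definitions (the edge set `F` "touching `O`" is a parameter with `hF : e ∈ F ↔ ∃ x ∈ e, x ∈ O`, and the involution of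
replica triples is a parameter `Φ`).

The registered kernel `stub_k0CovTransferQ_c9` ((T)) follows from the nonnegativity of the weight-free fibre counts
`fibreSumT o b u v c I` (`covTransferQ_of_fibres`, file `…FibreCriterion`); every argument towards those counts found so
far (crux memos LeadMath-c12 §1, EXCHCERT-g6 §5, FIBRE-PROBLEM.md) is an involution of the fibre that permutes replica
labels on the edges touching a vertex region.  This file provides the two reusable ingredients:

* (`exists_exit`, `reachable_diff_touching`, `reachable_iff_of_agree_off`) if every open edge touching a vertex set `O`
  stays inside `O ∪ Z`, an open path from `O` leaves through `Z`; if moreover no two distinct vertices of `Z` are joined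
  by open edges touching `O`, excursions into `O` can be excised, so connectivity between vertices outside `O` is
  decided by the edges not touching `O` and is unchanged when the configuration is modified on the edges touching `O`;
* (`fibreSum4_eq_zero_of_involution`) a signed fibre sum vanishes as soon as some count-preserving involution of replica
  triples negates its summand on the support (e.g. the coordinatewise swap of replicas 1 and 3 on the edges touching `O`).

The companion file `…FibreLocus` uses them to prove that all fibre counts of (T) vanish on ttrl2's equality locus.
[folklore] (2-vertex separator surgery on open paths; sign-reversing involutions)
-/

namespace Summit.CriticalPhenomena.PercolationContinuityZ3.Cruxes.AdditiveGluing.TieLine.FibreCount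

open MeasureTheory Set Finset Literature.Probability.Percolation
open Literature.Probability.LatticeModels (prodBernoulli)

open Classical

/-! ### Open paths and a region `O` whose allowed edges only lead to `O ∪ Z` -/

section Separator

variable {V : Type*}

/-! Throughout, `F` is the set of edges touching `O` (hypothesis `hF : ∀ e, e ∈ F ↔ ∃ x ∈ e, x ∈ O`). -/

/-! Throughout, "`O` is closed modulo `Z` for `ω`" is the hypothesis
`∀ e ∈ ω, ∀ x ∈ e, x ∈ O → ∀ y ∈ e, y ∈ O ∨ y ∈ Z`: every open edge with an endpoint in `O` has both endpoints in `O ∪ Z`,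
so open paths leave `O` only through `Z`. -/

/-- Closedness modulo `Z` is inherited by sub-configurations. [folklore] -/
theorem closedMod_mono {E₀ ω : Set (Sym2 V)} {O Z : Set V} (h : ∀ e ∈ E₀, ∀ x ∈ e, x ∈ O → ∀ y ∈ e, y ∈ O ∨ y ∈ Z)
    (hω : ω ⊆ E₀) : ∀ e ∈ ω, ∀ x ∈ e, x ∈ O → ∀ y ∈ e, y ∈ O ∨ y ∈ Z := fun e he => h e (hω he)

/-- An open edge from a vertex of `O` ends in `O ∪ Z`. [folklore] -/
theorem adj_mem_of_closed {ω : Set (Sym2 V)} {O Z : Set V} (h : ∀ e ∈ ω, ∀ x ∈ e, x ∈ O → ∀ y ∈ e, y ∈ O ∨ y ∈ Z)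
    {x y : V} (hxy : (openGraph ω).Adj x y) (hx : x ∈ O) : y ∈ O ∨ y ∈ Z := by
  rw [openGraph_adj] at hxy
  exact h _ hxy.1 x (Sym2.mem_mk_left x y) hx y (Sym2.mem_mk_right x y)

/-- An open edge into a vertex of `O` starts in `O ∪ Z`. [folklore] -/
theorem adj_mem_of_closed' {ω : Set (Sym2 V)} {O Z : Set V} (h : ∀ e ∈ ω, ∀ x ∈ e, x ∈ O → ∀ y ∈ e, y ∈ O ∨ y ∈ Z)
    {x y : V} (hxy : (openGraph ω).Adj x y) (hy : y ∈ O) : x ∈ O ∨ x ∈ Z :=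
  adj_mem_of_closed h hxy.symm hy

/-- An open edge with an endpoint in `O` is an open edge of `ω ∩ F`. [folklore] -/
theorem adj_inter_touching {ω F : Set (Sym2 V)} {O : Set V} (hF : ∀ e, e ∈ F ↔ ∃ x ∈ e, x ∈ O) {x y : V}
    (hxy : (openGraph ω).Adj x y) (h : x ∈ O ∨ y ∈ O) : (openGraph (ω ∩ F)).Adj x y := by
  rw [openGraph_adj] at hxy ⊢
  refine ⟨⟨hxy.1, (hF _).2 ?_⟩, hxy.2⟩
  rcases h with h | h
  · exact ⟨x, Sym2.mem_mk_left x y, h⟩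
  · exact ⟨y, Sym2.mem_mk_right x y, h⟩

/-- An open edge with no endpoint in `O` is an open edge of `ω \ F`. [folklore] -/
theorem adj_diff_touching {ω F : Set (Sym2 V)} {O : Set V} (hF : ∀ e, e ∈ F ↔ ∃ x ∈ e, x ∈ O) {x y : V}
    (hxy : (openGraph ω).Adj x y) (hx : x ∉ O) (hy : y ∉ O) : (openGraph (ω \ F)).Adj x y := by
  rw [openGraph_adj] at hxy ⊢
  refine ⟨⟨hxy.1, fun hmem => ?_⟩, hxy.2⟩
  obtain ⟨z, hz, hzO⟩ := (hF _).1 hmem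
  rcases Sym2.mem_iff.1 hz with rfl | rfl
  · exact hx hzO
  · exact hy hzO

/-- **First exit.**  If `O` is closed modulo `Z` for `ω`, an open path from `x ∈ O` to a vertex `y` can be cut at a vertex
`z` such that `x ↔ z` by open edges touching `O` and `z ↔ y`, where either `z = y ∈ O` or `z ∈ Z`. [folklore] -/
theorem exists_exit {ω F : Set (Sym2 V)} {O Z : Set V} (hF : ∀ e, e ∈ F ↔ ∃ x ∈ e, x ∈ O)
    (h : ∀ e ∈ ω, ∀ x ∈ e, x ∈ O → ∀ y ∈ e, y ∈ O ∨ y ∈ Z) {x y : V} (hx : x ∈ O)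
    (hxy : (openGraph ω).Reachable x y) :
    ((openGraph (ω ∩ F)).Reachable x y ∧ (y ∈ O ∨ y ∈ Z)) ∨
      ∃ z ∈ Z, (openGraph (ω ∩ F)).Reachable x z ∧ (openGraph ω).Reachable z y := by
  rw [SimpleGraph.reachable_iff_reflTransGen] at hxy
  induction hxy with
  | refl => exact Or.inl ⟨SimpleGraph.Reachable.refl x, Or.inl hx⟩
  | @tail b c _ hab ih =>
    rcases ih with ⟨hreach, hb⟩ | ⟨z, hz, hxz, hzb⟩
    · rcases hb with hb | hb
      · -- `b ∈ O`: the edge `b c` touches `O`, and `c ∈ O ∪ Z`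
        exact Or.inl ⟨hreach.trans (adj_inter_touching hF hab (Or.inl hb)).reachable, adj_mem_of_closed h hab hb⟩
      · by_cases hc : c ∈ O
        · exact Or.inl ⟨hreach.trans (adj_inter_touching hF hab (Or.inr hc)).reachable, Or.inl hc⟩
        · exact Or.inr ⟨b, hb, hreach, hab.reachable⟩
    · exact Or.inr ⟨z, hz, hxz, hzb.trans hab.reachable⟩

/-- **First exit, target outside `O`.** [folklore] -/
theorem exists_exit_of_not_mem {ω F : Set (Sym2 V)} {O Z : Set V} (hF : ∀ e, e ∈ F ↔ ∃ x ∈ e, x ∈ O)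
    (h : ∀ e ∈ ω, ∀ x ∈ e, x ∈ O → ∀ y ∈ e, y ∈ O ∨ y ∈ Z) {x y : V} (hx : x ∈ O)
    (hy : y ∉ O) (hxy : (openGraph ω).Reachable x y) :
    ∃ z ∈ Z, (openGraph (ω ∩ F)).Reachable x z ∧ (openGraph ω).Reachable z y := by
  rcases exists_exit hF h hx hxy with ⟨hreach, hy'⟩ | hz
  · rcases hy' with hy' | hy'
    · exact absurd hy' hy
    · exact ⟨y, hy', hreach, SimpleGraph.Reachable.refl y⟩
  · exact hz

/-- **Excursions into `O` can be excised.**  If `O` is closed modulo `Z` for `ω` and no two distinct vertices of `Z` are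
joined by open edges touching `O`, then two vertices outside `O` joined by an open path are joined by an open path using no
edge touching `O`. [folklore] -/
theorem reachable_diff_touching {ω F : Set (Sym2 V)} {O Z : Set V} (hF : ∀ e, e ∈ F ↔ ∃ x ∈ e, x ∈ O)
    (h : ∀ e ∈ ω, ∀ x ∈ e, x ∈ O → ∀ y ∈ e, y ∈ O ∨ y ∈ Z)
    (hZ : ∀ z₁ ∈ Z, ∀ z₂ ∈ Z, (openGraph (ω ∩ F)).Reachable z₁ z₂ → z₁ = z₂)
    {x y : V} (hx : x ∉ O) (hy : y ∉ O) (hxy : (openGraph ω).Reachable x y) :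
    (openGraph (ω \ F)).Reachable x y := by
  -- invariant along the path
  suffices H : ∀ y, Relation.ReflTransGen (openGraph ω).Adj x y →
      (y ∉ O → (openGraph (ω \ F)).Reachable x y) ∧
      (y ∈ O → ∃ z ∈ Z, (openGraph (ω \ F)).Reachable x z ∧ (openGraph (ω ∩ F)).Reachable z y) by
    exact (H y ((SimpleGraph.reachable_iff_reflTransGen _ _).1 hxy)).1 hy
  intro y hy
  induction hy with
  | refl => exact ⟨fun _ => SimpleGraph.Reachable.refl x, fun hx' => absurd hx' hx⟩
  | @tail b c _ hab ih =>
    constructor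
    · intro hc
      by_cases hb : b ∈ O
      · -- leaving `O` at `c ∈ Z`; the excursion started at some `z ∈ Z` with `z ↔ c` by edges touching `O`, hence `z = c`
        obtain ⟨z, hz, hxz, hzb⟩ := ih.2 hb
        have hcZ : c ∈ Z := (adj_mem_of_closed h hab hb).resolve_left hc
        have hzc : (openGraph (ω ∩ F)).Reachable z c := hzb.trans (adj_inter_touching hF hab (Or.inl hb)).reachable
        rw [hZ z hz c hcZ hzc] at hxz
        exact hxz
      · exact (ih.1 hb).trans (adj_diff_touching hF hab hb hc).reachable
    · intro hc
      by_cases hb : b ∈ O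
      · obtain ⟨z, hz, hxz, hzb⟩ := ih.2 hb
        exact ⟨z, hz, hxz, hzb.trans (adj_inter_touching hF hab (Or.inl hb)).reachable⟩
      · -- entering `O` from `b ∈ Z`
        have hbZ : b ∈ Z := (adj_mem_of_closed' h hab hc).resolve_left hb
        exact ⟨b, hbZ, ih.1 hb, (adj_inter_touching hF hab (Or.inr hc)).reachable⟩

/-- **Splicing.**  Under the hypotheses of `reachable_diff_touching`, connectivity between vertices outside `O` is decided by
the edges not touching `O`: for two configurations that agree off `touching O` (and both satisfy the excision hypothesis)
it is the same. [folklore] -/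
theorem reachable_iff_of_agree_off {ω ω' F : Set (Sym2 V)} {O Z : Set V} (hF : ∀ e, e ∈ F ↔ ∃ x ∈ e, x ∈ O)
    (h : ∀ e ∈ ω, ∀ x ∈ e, x ∈ O → ∀ y ∈ e, y ∈ O ∨ y ∈ Z) (h' : ∀ e ∈ ω', ∀ x ∈ e, x ∈ O → ∀ y ∈ e, y ∈ O ∨ y ∈ Z)
    (hZ : ∀ z₁ ∈ Z, ∀ z₂ ∈ Z, (openGraph (ω ∩ F)).Reachable z₁ z₂ → z₁ = z₂)
    (hZ' : ∀ z₁ ∈ Z, ∀ z₂ ∈ Z, (openGraph (ω' ∩ F)).Reachable z₁ z₂ → z₁ = z₂)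
    (hagree : ω \ F = ω' \ F) {x y : V} (hx : x ∉ O) (hy : y ∉ O) :
    (openGraph ω).Reachable x y ↔ (openGraph ω').Reachable x y := by
  constructor
  · intro hxy
    have := reachable_diff_touching hF h hZ hx hy hxy
    rw [hagree] at this
    exact this.mono (BHK2006.openGraph_le Set.sdiff_subset)
  · intro hxy
    have := reachable_diff_touching hF h' hZ' hx hy hxy
    rw [← hagree] at this
    exact this.mono (BHK2006.openGraph_le Set.sdiff_subset)

end Separator

/-! ### Sign-reversing involutions of a fibre -/

section Involution

variable {ι : Type*} [Fintype ι]

/-- **Sign-reversing involution ⇒ vanishing fibre sum.**  If a count-preserving involution `Φ` of replica triples reverses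
the sign of the signed summand on every triple of the fibre `{cnt = I}` where the summand is non-zero, then the signed
fibre sum `fibreSum4 … I` vanishes (off the support the summand of the image vanishes too, `Φ` being an involution).
[folklore] -/
theorem fibreSum4_eq_zero_of_involution (Φ : Triple ι → Triple ι) (hΦ : ∀ t, Φ (Φ t) = t) (hcnt : ∀ t, cnt (Φ t) = cnt t)
    (s₀ s₁ s₂ s₃ : ℝ) (A₀ A₁ A₂ B₀ B₁ B₂ C₀ C₁ C₂ D₀ D₁ D₂ : Set (Set ι)) (I : ι → ℕ)
    (h : ∀ t : Triple ι, cnt t = I →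
      s₀ * ind A₀ A₁ A₂ t + s₁ * ind B₀ B₁ B₂ t + s₂ * ind C₀ C₁ C₂ t + s₃ * ind D₀ D₁ D₂ t ≠ 0 →
      s₀ * ind A₀ A₁ A₂ (Φ t) + s₁ * ind B₀ B₁ B₂ (Φ t) + s₂ * ind C₀ C₁ C₂ (Φ t) + s₃ * ind D₀ D₁ D₂ (Φ t) =
        -(s₀ * ind A₀ A₁ A₂ t + s₁ * ind B₀ B₁ B₂ t + s₂ * ind C₀ C₁ C₂ t + s₃ * ind D₀ D₁ D₂ t)) :
    fibreSum4 s₀ s₁ s₂ s₃ A₀ A₁ A₂ B₀ B₁ B₂ C₀ C₁ C₂ D₀ D₁ D₂ I = 0 := by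
  unfold fibreSum4
  set f : Triple ι → ℝ := fun t =>
    s₀ * ind A₀ A₁ A₂ t + s₁ * ind B₀ B₁ B₂ t + s₂ * ind C₀ C₁ C₂ t + s₃ * ind D₀ D₁ D₂ t with hf
  -- the sign reversal holds on the whole fibre
  have hall : ∀ t : Triple ι, cnt t = I → f (Φ t) = -f t := by
    intro t ht
    by_cases h0 : f t = 0
    · by_cases h1 : f (Φ t) = 0
      · rw [h0, h1, neg_zero]
      · have h2 : f t = -f (Φ t) := by
          have := h (Φ t) (by rw [hcnt, ht]) h1
          rwa [hΦ] at this
        exfalso; apply h1; linarith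
    · exact h t ht h0
  refine Finset.sum_involution (fun t _ => Φ t) (fun t ht => ?_) (fun t ht hne => ?_) (fun t ht => ?_)
    (fun t ht => hΦ t)
  · have := hall t (Finset.mem_filter.1 ht).2
    change f t + f (Φ t) = 0
    rw [this, add_neg_cancel]
  · intro heq
    apply hne
    have := hall t (Finset.mem_filter.1 ht).2
    rw [heq] at this
    change f t = 0
    linarith
  · exact Finset.mem_filter.2 ⟨Finset.mem_univ _, by rw [hcnt, (Finset.mem_filter.1 ht).2]⟩

omit [Fintype ι] in
/-- On the fibre of a count vector supported on `E₀`, every replica is a sub-configuration of `E₀`. [folklore] -/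
theorem cfg_subset_of_cnt_eq {E₀ : Set ι} {I : ι → ℕ} (hI : ∀ i, i ∉ E₀ → I i = 0) {t : Triple ι} (ht : cnt t = I) :
    cfg t.1 ⊆ E₀ ∧ cfg t.2.1 ⊆ E₀ ∧ cfg t.2.2 ⊆ E₀ := by
  have key : ∀ i, i ∉ E₀ → t.1 i = false ∧ t.2.1 i = false ∧ t.2.2 i = false := by
    intro i hi
    have h0 : cnt t i = 0 := by rw [ht]; exact hI i hi
    unfold cnt cnt3 at h0
    refine ⟨?_, ?_, ?_⟩
    · cases h1 : t.1 i
      · rfl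
      · rw [h1] at h0; simp at h0
    · cases h1 : t.2.1 i
      · rfl
      · rw [h1] at h0; simp at h0
    · cases h1 : t.2.2 i
      · rfl
      · rw [h1] at h0; simp at h0
  refine ⟨fun i hi => ?_, fun i hi => ?_, fun i hi => ?_⟩ <;>
  · by_contra hE
    have := key i hE
    simp only [cfg, Set.mem_setOf_eq] at hi
    simp_all

end Involution

end Summit.CriticalPhenomena.PercolationContinuityZ3.Cruxes.AdditiveGluing.TieLine.FibreCount
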